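import Mathlib
import Summits.ValiantsHypothesis.ValiantsHypothesis.Theorems.NewtonUnitEquationsNewtonTauWeakCornerWords
import Summits.ValiantsHypothesis.ValiantsHypothesis.Theorems.NewtonUnitEquationsNewtonTauWeakK3PaperDefs

/-!
# `NewtonTauWeak` (stmt-ValiantsHypothesis-5904), sub-stub `fixedKCoincidence_t2_K3`: primitive vectors and
# local rays of an exponent list

Support file (paper transcription of `Cruxes/NewtonTauWeak/Lines/binomial-normal-form-ltc.md` §2) for the crux
`Summit.ValiantsHypothesis.ValiantsHypothesis.Theses.NewtonUnitEquations.NewtonTauWeak`.  Elementary lattice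
geometry of the objects `mult`, `prim`, `ray`, `rays`, `posSet` of `…K3PaperDefs.lean`: `a = mult a • prim a`,
parallel nonzero exponents of `ℕ²` have the same primitive vector (coprimality), a multiple of a local ray is
parallel to its exponent, and RAYS DETERMINE DIRECTIONS (`ray_eq_of_smul_eq`): `k • ray_j = k' • ray_{j'}` with
`k ≥ 1` forces `d_j ∥ d_{j'}` and `ray_j = ray_{j'}` — so any injective enumeration of the ray set satisfies the
non-parallelism hypothesis `hE` of the corner lemmas (`rays_hE`, anchor `k3p_rays_hE`); for the sign pattern
of a generic weight `w` every local ray has positive `(-w)`-weight (`wt_neg_ray_pos`).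
No definitions. [folklore]
-/

-- the namespace mandated for this Theorems file repeats the component `ValiantsHypothesis`
set_option linter.dupNamespace false

noncomputable section

open scoped BigOperators Polynomial
open Summit.ValiantsHypothesis.ValiantsHypothesis.Theorems.NewtonTauWeakCorner (wt push OnRay wt_add wt_zero
  wt_zsmul wt_push push_zero push_single)
open Summit.ValiantsHypothesis.ValiantsHypothesis.Theorems.NewtonTauWeakVdp (wdeg IsGeneric)

namespace Summit.ValiantsHypothesis.ValiantsHypothesis.Theorems.NewtonTauWeakK3Paper

/-! ## `mult` and `prim` -/

/-- Routine API (`mult_pos`). [folklore] -/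
theorem mult_pos {a : Fin 2 →₀ ℕ} (ha : a ≠ 0) : 0 < mult a := by
  unfold mult
  by_contra h
  have h0 : Nat.gcd (a 0) (a 1) = 0 := by omega
  rw [Nat.gcd_eq_zero_iff] at h0
  apply ha
  ext i
  fin_cases i
  · exact h0.1
  · exact h0.2

/-- Routine API (`mult_dvd`). [folklore] -/
theorem mult_dvd (a : Fin 2 →₀ ℕ) (i : Fin 2) : mult a ∣ a i := by
  unfold mult
  fin_cases i
  · exact Nat.gcd_dvd_left _ _
  · exact Nat.gcd_dvd_right _ _

/-- `a = mult(a) · prim(a)` coordinatewise. [folklore] -/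
theorem mult_mul_prim (a : Fin 2 →₀ ℕ) (i : Fin 2) : ((mult a : ℕ) : ℤ) * prim a i = ((a i : ℕ) : ℤ) := by
  unfold prim
  have := Nat.mul_div_cancel' (mult_dvd a i)
  exact_mod_cast this

/-- Routine API (`prim_nonneg`). [folklore] -/
theorem prim_nonneg (a : Fin 2 →₀ ℕ) (i : Fin 2) : 0 ≤ prim a i := by
  unfold prim; positivity

/-- Routine API (`prim_ne_zero`). [folklore] -/
theorem prim_ne_zero {a : Fin 2 →₀ ℕ} (ha : a ≠ 0) : prim a ≠ 0 := by
  intro h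
  apply ha
  ext i
  have h1 := mult_mul_prim a i
  rw [h, Pi.zero_apply, mul_zero] at h1
  simp only [Finsupp.coe_zero, Pi.zero_apply]
  exact_mod_cast h1.symm

/-- Routine API (`prim_coprime`). [folklore] -/
theorem prim_coprime {a : Fin 2 →₀ ℕ} (ha : a ≠ 0) : Nat.Coprime (a 0 / mult a) (a 1 / mult a) := by
  unfold mult
  exact Nat.coprime_div_gcd_div_gcd (mult_pos ha)

/-- Parallel nonzero exponents have the same primitive vector. [folklore] -/
theorem prim_eq_of_parallel {a b : Fin 2 →₀ ℕ} (ha : a ≠ 0) (hb : b ≠ 0)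
    (hpar : ((a 0 : ℕ) : ℤ) * ((b 1 : ℕ) : ℤ) = ((a 1 : ℕ) : ℤ) * ((b 0 : ℕ) : ℤ)) : prim a = prim b := by
  -- reduce to the coprime quotients
  set p0 := a 0 / mult a with hp0
  set p1 := a 1 / mult a with hp1
  set q0 := b 0 / mult b with hq0
  set q1 := b 1 / mult b with hq1
  have hca : Nat.Coprime p0 p1 := prim_coprime ha
  have hcb : Nat.Coprime q0 q1 := prim_coprime hb
  have ha0 : a 0 = mult a * p0 := (Nat.mul_div_cancel' (mult_dvd a 0)).symm
  have ha1 : a 1 = mult a * p1 := (Nat.mul_div_cancel' (mult_dvd a 1)).symm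
  have hb0 : b 0 = mult b * q0 := (Nat.mul_div_cancel' (mult_dvd b 0)).symm
  have hb1 : b 1 = mult b * q1 := (Nat.mul_div_cancel' (mult_dvd b 1)).symm
  have hma := mult_pos ha
  have hmb := mult_pos hb
  have hpar' : p0 * q1 = p1 * q0 := by
    have h : (a 0 : ℕ) * b 1 = a 1 * b 0 := by exact_mod_cast hpar
    rw [ha0, ha1, hb0, hb1] at h
    have h' : (mult a * mult b) * (p0 * q1) = (mult a * mult b) * (p1 * q0) := by
      calc (mult a * mult b) * (p0 * q1) = mult a * p0 * (mult b * q1) := by ring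
        _ = mult a * p1 * (mult b * q0) := h
        _ = (mult a * mult b) * (p1 * q0) := by ring
    exact Nat.eq_of_mul_eq_mul_left (Nat.mul_pos hma hmb) h'
  -- p0 = q0
  have h00 : p0 = q0 := by
    apply Nat.dvd_antisymm
    · have : p0 ∣ p1 * q0 := ⟨q1, by rw [← hpar']⟩
      exact hca.dvd_of_dvd_mul_left this
    · have : q0 ∣ q1 * p0 := ⟨p1, by linarith [hpar']⟩
      exact hcb.dvd_of_dvd_mul_left this
  have h11 : p1 = q1 := by
    by_cases hp : p0 = 0
    · have h1 : p1 = 1 := by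
        have := hca; rw [hp, Nat.coprime_zero_left] at this; exact this
      have h2 : q1 = 1 := by
        have := hcb; rw [← h00, hp, Nat.coprime_zero_left] at this; exact this
      rw [h1, h2]
    · rw [← h00] at hpar'
      have : p0 * q1 = p0 * p1 := by rw [hpar']; ring
      exact (Nat.eq_of_mul_eq_mul_left (Nat.pos_of_ne_zero hp) this).symm
  funext i
  unfold prim
  fin_cases i
  · change ((p0 : ℕ) : ℤ) = ((q0 : ℕ) : ℤ)
    rw [h00]
  · change ((p1 : ℕ) : ℤ) = ((q1 : ℕ) : ℤ)
    rw [h11]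

/-- Exponents with parallel primitive vectors are parallel. [folklore] -/
theorem parallel_of_prim_parallel {a b : Fin 2 →₀ ℕ} (h : prim a 0 * prim b 1 = prim a 1 * prim b 0) :
    ((a 0 : ℕ) : ℤ) * ((b 1 : ℕ) : ℤ) = ((a 1 : ℕ) : ℤ) * ((b 0 : ℕ) : ℤ) := by
  rw [← mult_mul_prim a 0, ← mult_mul_prim a 1, ← mult_mul_prim b 0, ← mult_mul_prim b 1]
  calc (mult a : ℤ) * prim a 0 * ((mult b : ℤ) * prim b 1) = (mult a : ℤ) * mult b * (prim a 0 * prim b 1) := by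
        ring
    _ = (mult a : ℤ) * mult b * (prim a 1 * prim b 0) := by rw [h]
    _ = (mult a : ℤ) * prim a 1 * ((mult b : ℤ) * prim b 0) := by ring

/-- A multiple of `prim a` is parallel to `a`. [folklore] -/
theorem smul_prim_parallel (a : Fin 2 →₀ ℕ) (c : ℤ) :
    (c • prim a) 0 * ((a 1 : ℕ) : ℤ) = (c • prim a) 1 * ((a 0 : ℕ) : ℤ) := by
  rw [← mult_mul_prim a 0, ← mult_mul_prim a 1]
  simp only [Pi.smul_apply, smul_eq_mul]
  ring

/-! ## Rays -/

/-- Routine API (`ray_eq_smul_prim`). [folklore] -/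
theorem ray_eq_smul_prim {N : ℕ} (d : Fin N → (Fin 2 →₀ ℕ)) (S : Finset (Fin N)) (j : Fin N) :
    ∃ σ : ℤ, (σ = 1 ∨ σ = -1) ∧ ray d S j = σ • prim (d j) := by
  unfold ray
  split_ifs
  · exact ⟨-1, Or.inr rfl, by rw [neg_one_zsmul]⟩
  · exact ⟨1, Or.inl rfl, by rw [one_zsmul]⟩

/-- Routine API (`ray_ne_zero`). [folklore] -/
theorem ray_ne_zero {N : ℕ} (d : Fin N → (Fin 2 →₀ ℕ)) (S : Finset (Fin N)) {j : Fin N} (hj : d j ≠ 0) :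
    ray d S j ≠ 0 := by
  unfold ray
  split_ifs
  · rw [neg_ne_zero]; exact prim_ne_zero hj
  · exact prim_ne_zero hj

/-- A multiple of a ray is parallel to its exponent. [folklore] -/
theorem smul_ray_parallel {N : ℕ} (d : Fin N → (Fin 2 →₀ ℕ)) (S : Finset (Fin N)) (j : Fin N) (c : ℤ) :
    (c • ray d S j) 0 * ((d j 1 : ℕ) : ℤ) = (c • ray d S j) 1 * ((d j 0 : ℕ) : ℤ) := by
  obtain ⟨σ, -, h⟩ := ray_eq_smul_prim d S j
  rw [h, smul_smul]
  exact smul_prim_parallel (d j) _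

/-- **Rays determine directions**: if positive multiples of two rays agree (the first multiple being
nonzero), the rays are equal. [folklore] -/
theorem ray_eq_of_smul_eq {N : ℕ} (d : Fin N → (Fin 2 →₀ ℕ)) (S : Finset (Fin N)) {j j' : Fin N}
    (hj : d j ≠ 0) (hj' : d j' ≠ 0) (k k' : ℕ) (hk : 1 ≤ k)
    (h : (k : ℤ) • ray d S j = (k' : ℤ) • ray d S j') :
    ((d j 0 : ℕ) : ℤ) * ((d j' 1 : ℕ) : ℤ) = ((d j 1 : ℕ) : ℤ) * ((d j' 0 : ℕ) : ℤ) ∧ ray d S j = ray d S j' := by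
  obtain ⟨σ, hσ, hr⟩ := ray_eq_smul_prim d S j
  obtain ⟨σ', hσ', hr'⟩ := ray_eq_smul_prim d S j'
  have hpj := prim_ne_zero hj
  -- coordinates
  have hc : ∀ i, (k : ℤ) * σ * prim (d j) i = (k' : ℤ) * σ' * prim (d j') i := by
    intro i
    have := congrFun h i
    rw [hr, hr'] at this
    simp only [Pi.smul_apply, smul_eq_mul] at this
    linarith [this]
  -- k' ≠ 0
  have hk' : k' ≠ 0 := by
    rintro rfl
    apply hpj
    funext i
    have := hc i
    simp only [Nat.cast_zero, zero_mul] at this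
    have hkσ : (k : ℤ) * σ ≠ 0 := by
      apply mul_ne_zero
      · exact_mod_cast (by omega : k ≠ 0)
      · rcases hσ with rfl | rfl <;> norm_num
    exact (mul_eq_zero.mp this).resolve_left hkσ
  -- parallel prims
  have hpp : prim (d j) 0 * prim (d j') 1 = prim (d j) 1 * prim (d j') 0 := by
    have h0 := hc 0
    have h1 := hc 1
    have hkσ : (k' : ℤ) * σ' ≠ 0 := by
      apply mul_ne_zero
      · exact_mod_cast hk'
      · rcases hσ' with rfl | rfl <;> norm_num
    have : ((k' : ℤ) * σ') * (prim (d j) 0 * prim (d j') 1) = ((k' : ℤ) * σ') * (prim (d j) 1 * prim (d j') 0) := by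
      calc ((k' : ℤ) * σ') * (prim (d j) 0 * prim (d j') 1) = prim (d j) 0 * ((k' : ℤ) * σ' * prim (d j') 1) := by ring
        _ = prim (d j) 0 * ((k : ℤ) * σ * prim (d j) 1) := by rw [h1]
        _ = ((k : ℤ) * σ * prim (d j) 0) * prim (d j) 1 := by ring
        _ = ((k' : ℤ) * σ' * prim (d j') 0) * prim (d j) 1 := by rw [h0]
        _ = ((k' : ℤ) * σ') * (prim (d j) 1 * prim (d j') 0) := by ring
    exact mul_left_cancel₀ hkσ this
  have hpar := parallel_of_prim_parallel hpp
  refine ⟨hpar, ?_⟩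
  have hpeq : prim (d j) = prim (d j') := prim_eq_of_parallel hj hj' hpar
  -- signs agree
  rw [hr, hr', hpeq]
  obtain ⟨i, hi⟩ : ∃ i, prim (d j') i ≠ 0 := by
    by_contra hall
    push Not at hall
    exact prim_ne_zero hj' (funext hall)
  have hci := hc i
  rw [hpeq] at hci
  have hkk : (k : ℤ) * σ = (k' : ℤ) * σ' := mul_right_cancel₀ hi hci
  have hσσ : σ = σ' := by
    rcases hσ with rfl | rfl <;> rcases hσ' with rfl | rfl
    · rfl
    · exfalso; have : (k : ℤ) = -(k' : ℤ) := by linarith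
      omega
    · exfalso; have : -(k : ℤ) = (k' : ℤ) := by linarith
      omega
    · rfl
  rw [hσσ]

/-- The non-parallelism hypothesis `hE` of the corner lemmas holds for any enumeration of the rays.
[folklore] -/
theorem rays_hE {N s : ℕ} (d : Fin N → (Fin 2 →₀ ℕ)) (S : Finset (Fin N)) (E : Fin s → Fin 2 → ℤ)
    (hE : ∀ e, E e ∈ rays d S) (hinj : Function.Injective E) :
    ∀ e e' : Fin s, ∀ k k' : ℕ, 1 ≤ k → (k : ℤ) • E e = (k' : ℤ) • E e' → e = e' := by
  intro e e' k k' hk h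
  obtain ⟨j, hj, hje⟩ := Finset.mem_image.mp (hE e)
  obtain ⟨j', hj', hje'⟩ := Finset.mem_image.mp (hE e')
  rw [Finset.mem_filter] at hj hj'
  rw [← hje, ← hje'] at h
  have := (ray_eq_of_smul_eq d S hj.2 hj'.2 k k' hk h).2
  apply hinj
  rw [← hje, ← hje', this]

/-- Weight of a ray: positive for the weight `-w` when `S` is the sign pattern of a generic `w`.
[folklore] -/
theorem wt_neg_ray_pos {N : ℕ} {w : Fin 2 → ℝ} (hw : IsGeneric w) (d : Fin N → (Fin 2 →₀ ℕ)) {j : Fin N}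
    (hj : d j ≠ 0) : 0 < wt (-w) (ray d (posSet w d) j) := by
  have hmult : (0 : ℝ) < mult (d j) := by exact_mod_cast mult_pos hj
  have hdeg : wdeg w (d j) = (mult (d j) : ℝ) * wt w (prim (d j)) := by
    simp only [wdeg, wt]
    have h0 := mult_mul_prim (d j) 0
    have h1 := mult_mul_prim (d j) 1
    have h0' : ((d j 0 : ℕ) : ℝ) = (mult (d j) : ℝ) * (prim (d j) 0 : ℝ) := by exact_mod_cast h0.symm
    have h1' : ((d j 1 : ℕ) : ℝ) = (mult (d j) : ℝ) * (prim (d j) 1 : ℝ) := by exact_mod_cast h1.symm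
    rw [h0', h1']; ring
  have hne : wdeg w (d j) ≠ 0 := by
    intro h0
    apply hj
    have : wdeg w (d j) = wdeg w 0 := by
      rw [h0, Summit.ValiantsHypothesis.ValiantsHypothesis.Theorems.NewtonTauWeakVdp.wdeg_zero]
    exact hw this
  unfold ray posSet
  simp only [Finset.mem_filter, Finset.mem_univ, true_and]
  split_ifs with hpos
  · have : wt (-w) (-prim (d j)) = wt w (prim (d j)) := by simp [wt]
    rw [this]
    rw [hdeg] at hpos
    exact pos_of_mul_pos_right hpos hmult.le
  · have hneg : wdeg w (d j) < 0 := lt_of_le_of_ne (not_lt.mp hpos) hne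
    have : wt (-w) (prim (d j)) = - wt w (prim (d j)) := by simp [wt]; ring
    rw [this]
    rw [hdeg] at hneg
    have := neg_of_mul_neg_right hneg hmult.le
    linarith

/-- Exponents on the same local ray have the same primitive vector. [folklore] -/
theorem prim_eq_of_ray_eq {N : ℕ} (d : Fin N → (Fin 2 →₀ ℕ)) (S : Finset (Fin N)) {j j' : Fin N}
    (hj : d j ≠ 0) (hj' : d j' ≠ 0) (h : ray d S j = ray d S j') : prim (d j) = prim (d j') := by
  have := ray_eq_of_smul_eq d S hj hj' 1 1 le_rfl (by rw [h])
  exact prim_eq_of_parallel hj hj' this.1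

/-- The exponent itself is `mult • prim` as an integer vector. [folklore] -/
theorem natCast_eq_mult_smul_prim (a : Fin 2 →₀ ℕ) : (fun i => ((a i : ℕ) : ℤ)) = (mult a : ℤ) • prim a := by
  funext i
  rw [Pi.smul_apply, smul_eq_mul, mult_mul_prim]

/-- ANCHOR (registered helper stub): the non-parallelism hypothesis `hE` of the corner lemmas for an injective
enumeration of the local rays. [folklore] -/
theorem k3p_rays_hE {N s : ℕ} (d : Fin N → (Fin 2 →₀ ℕ)) (S : Finset (Fin N)) (E : Fin s → Fin 2 → ℤ) (hE : ∀ e, E e ∈ rays d S) (hinj : Function.Injective E) : ∀ e e' : Fin s, ∀ k k' : ℕ, 1 ≤ k → (k : ℤ) • E e = (k' : ℤ) • E e' → e = e' :=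
  rays_hE d S E hE hinj

end Summit.ValiantsHypothesis.ValiantsHypothesis.Theorems.NewtonTauWeakK3Paper

end
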